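import Mathlib
import HarnessLib

/-!
# WeilTypeLadder · the comb pieces of a compact ordering — leg-count parity (every `m`, every `N`) and compact orderings for `N = 4`

b2b cell `hweil` (packet `run/shared/lean/b2b/hodge-weil/`, report `b2b-hweil-pv3-g40/COMB-PIECES.md`, prover 3
generation 40). PURE COMBINATORICS on `ℤ/m`, no geometry, no named fact, no `decide` over data; sibling of
`Theorems/WeilTypeLadderCyclicSexticOrderings` (compact orderings of Weil-type `ℤ/6` tuples, all `N`).

THEOREM DISC-PIECES of the packet (comb degeneration, pen-and-paper): for a cyclic `ℤ/m`-cover of `ℙ¹` whose rotation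
numbers `β₁, …, β_N ∈ ℤ/m ∖ {0}` (`Σ βᵢ = 0`) are listed in a COMPACT ORDERING (all proper prefix sums
`s_k = β₁ + ⋯ + β_k ≠ 0`, `1 ≤ k ≤ N-1`), the discriminant class of the `ζ_m`-primitive Prym over an imaginary quadratic
`K ⊂ ℚ(ζ_m)` is the product of the classes of the `N - 2` THREE-POINT PIECES with rotation triples `(s_{k-1}, β_k, -s_k)`,
`k = 2, …, N-1` (CM abelian varieties; PIECE TABLES by machine). For `m = 18` (resp. `6`) and `K = ℚ(√-3)` a piece has
non-trivial class (`±2`) exactly when one of its legs is the element `t = 9` (resp. `3`) of order two, so the class of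
the cover is `(-1)^{n₀} · 2^{#pieces with a t-leg}`. This file proves the bookkeeping that turns this into
`(-1)^{n₀} · 2^{#{i : βᵢ = t}}` (THEOREM DISC-18 / DISC-6 step (3)), for every `m`, every `t` with `t + t = 0`, every `N`:

* `combPieces_legs_count_eq` / `combPieces_legs_count_add_even_iff` — the total number of `t`-legs over all pieces
  (first legs `s_1..s_{N-2}`, middle legs `β_2..β_{N-1}`, last legs `-s_2..-s_{N-1}`) is
  `l.count t + 2·#{2 ≤ k ≤ N-2 : s_k = t}`, hence has the parity of `#{i : βᵢ = t}` (every inner prefix sum equal to `t`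
  is a leg of two consecutive pieces; `s_1 = β_1`, `-s_{N-1} = β_N`; `-x = t ↔ x = t`);
* `combPieces_countP_hasLeg_eq` — when no letter and no proper prefix sum is `0` a piece has AT MOST ONE `t`-leg (two
  would force the third to be `-(t+t) = 0`), so the number of pieces with a `t`-leg IS that total;
* `combPieces_even_iff` — hence `#{pieces with a t-leg} ≡ #{i : βᵢ = t} (mod 2)`;
* `compactOrdering_exists_four` — for `N = 4` and every `m`, four non-zero residues summing to `0`, not all equal to
  one element of order two, admit a compact ordering (the hypothesis of THEOREM DISC-PIECES for every quadruple of the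
  packet's `N = 4` scans: a connected tuple is never `(m/2)⁴`).

HONEST LABEL: bookkeeping for the packet's THEOREM DISC-PIECES / DISC-18 (whose degeneration step stays pen-and-paper
and whose piece tables are machine); 0 rungs; nothing of Markman 2025 / Mostaed 2026 / Perry 2026 is used.
-/

-- every declaration of this problem lives in `Summit.HodgeConjecture.HodgeConjecture.…` (summit = sub-problem)
set_option linter.dupNamespace false

namespace Summit.HodgeConjecture.HodgeConjecture.WeilTypeLadder

section CombPieces

variable {m : ℕ}

/-- In `ℤ/m`, if `t + t = 0` then `-x = t ↔ x = t`. [folklore] -/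
theorem neg_eq_iff_eq_of_add_self_eq_zero {t : ZMod m} (ht : t + t = 0) (x : ZMod m) : -x = t ↔ x = t := by
  have h : -t = t := by
    have := congrArg (· - t) ht; simpa using this.symm
  constructor
  · intro hx; have := congrArg Neg.neg hx; simpa [h] using this
  · intro hx; rw [hx, h]

/-- Counting a disjunction of three pairwise exclusive predicates over a list is the sum of the three counts. [folklore] -/
theorem countP_or_or_eq_of_exclusive {α : Type*} (p q r : α → Prop) [DecidablePred p] [DecidablePred q]
    [DecidablePred r] (js : List α)
    (hpq : ∀ j ∈ js, ¬ (p j ∧ q j)) (hpr : ∀ j ∈ js, ¬ (p j ∧ r j)) (hqr : ∀ j ∈ js, ¬ (q j ∧ r j)) :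
    js.countP (fun j => p j ∨ q j ∨ r j) = js.countP p + js.countP q + js.countP r := by
  induction js with
  | nil => simp
  | cons a js ih =>
    have ih' := ih (fun j hj => hpq j (by simp [hj])) (fun j hj => hpr j (by simp [hj]))
      (fun j hj => hqr j (by simp [hj]))
    have ha1 := hpq a (by simp); have ha2 := hpr a (by simp); have ha3 := hqr a (by simp)
    simp only [List.countP_cons, ih']
    by_cases h1 : p a <;> by_cases h2 : q a <;> by_cases h3 : r a <;> simp_all <;> omega

/-- Counting the value `t` in a mapped list is counting the indices where the function takes the value `t`. [folklore] -/
theorem count_map_eq_countP {α : Type*} (g : α → ZMod m) (t : ZMod m) (js : List α) :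
    (js.map g).count t = js.countP (fun j => g j = t) := by
  rw [List.count, List.countP_map]
  apply List.countP_congr
  intro j _
  simp [Function.comp, beq_iff_eq]

/-- **Leg-count identity.** With `s_k = (l.take k).sum`, `N = l.length ≥ 3`, `l.sum = 0`, `t + t = 0`:
`#{t among s_1..s_{N-2}} + #{t among β_2..β_{N-1}} + #{t among -s_2..-s_{N-1}} = l.count t + 2·#{2 ≤ k ≤ N-2 : s_k = t}`.
[folklore] -/
theorem combPieces_legs_count_eq (t : ZMod m) (ht : t + t = 0) (l : List (ZMod m)) (hl : 3 ≤ l.length)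
    (hs : l.sum = 0) :
    ((List.range (l.length - 2)).map (fun j => (l.take (j + 1)).sum)).count t
        + ((l.drop 1).take (l.length - 2)).count t
        + ((List.range (l.length - 2)).map (fun j => -(l.take (j + 2)).sum)).count t
      = l.count t + 2 * ((List.range (l.length - 3)).map (fun j => (l.take (j + 2)).sum)).count t := by
  obtain ⟨n, hn⟩ : ∃ n, l.length = n + 3 := ⟨l.length - 3, by omega⟩
  have e2 : l.length - 2 = n + 1 := by omega
  have e3 : l.length - 3 = n := by omega
  rw [e2, e3]
  -- last legs: `-s = t ↔ s = t`
  have hlast : ((List.range (n + 1)).map (fun j => -(l.take (j + 2)).sum)).count t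
      = ((List.range (n + 1)).map (fun j => (l.take (j + 2)).sum)).count t := by
    rw [count_map_eq_countP, count_map_eq_countP]
    apply List.countP_congr
    intro j _
    simp only [decide_eq_true_eq]
    exact neg_eq_iff_eq_of_add_self_eq_zero ht _
  rw [hlast]
  -- first legs = s_1 :: (s_2 .. s_{N-2});  (s_2 .. s_{N-1}) = (s_2 .. s_{N-2}) ++ [s_{N-1}]
  have hfirst : (List.range (n + 1)).map (fun j => (l.take (j + 1)).sum)
      = (l.take 1).sum :: (List.range n).map (fun j => (l.take (j + 2)).sum) := by
    rw [List.range_succ_eq_map, List.map_cons, List.map_map]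
    rfl
  have hsecond : (List.range (n + 1)).map (fun j => (l.take (j + 2)).sum)
      = (List.range n).map (fun j => (l.take (j + 2)).sum) ++ [(l.take (n + 2)).sum] := by
    rw [List.range_succ, List.map_append, List.map_singleton]
  rw [hfirst, hsecond, List.count_cons, List.count_append]
  -- the letters: l = [x] ++ middle ++ [y]
  have hsplit : l = l.take 1 ++ ((l.drop 1).take (n + 1) ++ l.drop (n + 2)) := by
    conv_lhs => rw [← List.take_append_drop 1 l, ← List.take_append_drop (n + 1) (l.drop 1)]
    rw [List.drop_drop, show 1 + (n + 1) = n + 2 by ring]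
  obtain ⟨x, hx⟩ : ∃ x, l.take 1 = [x] := by
    refine ⟨l.take 1 |>.headI, ?_⟩
    have : (l.take 1).length = 1 := by simp; omega
    match h : l.take 1, this with
    | [a], _ => rfl
  obtain ⟨y, hy⟩ : ∃ y, l.drop (n + 2) = [y] := by
    have : (l.drop (n + 2)).length = 1 := by simp; omega
    match h : l.drop (n + 2), this with
    | [a], _ => exact ⟨a, rfl⟩
  have hcount : l.count t = [x].count t + ((l.drop 1).take (n + 1)).count t + [y].count t := by
    conv_lhs => rw [hsplit]
    rw [List.count_append, List.count_append, hx, hy]; ring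
  have hsum : (l.take (n + 2)).sum + y = 0 := by
    have := List.sum_take_add_sum_drop l (n + 2)
    rw [hy, List.sum_singleton] at this
    rw [this, hs]
  have hy' : ([y].count t) = if (l.take (n + 2)).sum = t then 1 else 0 := by
    have ey : y = -(l.take (n + 2)).sum := (add_eq_zero_iff_neg_eq.mp hsum).symm
    rw [List.count_singleton', ey]
    by_cases h : (l.take (n + 2)).sum = t
    · rw [if_pos h, if_pos ((neg_eq_iff_eq_of_add_self_eq_zero ht _).mpr h)]
    · rw [if_neg h, if_neg (fun h' => h ((neg_eq_iff_eq_of_add_self_eq_zero ht _).mp h'))]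
  have hx' : ([x].count t) = if (l.take 1).sum = t then 1 else 0 := by
    rw [hx, List.sum_singleton, List.count_singleton']
  rw [hcount, hx', hy']
  have h1 : (if ((List.take 1 l).sum == t) = true then 1 else 0) = (if (List.take 1 l).sum = t then 1 else 0) := by
    simp only [beq_iff_eq]
  have h2 : List.count t [(List.take (n + 2) l).sum] = if (List.take (n + 2) l).sum = t then 1 else 0 := by
    rw [List.count_singleton']
  rw [h1, h2]
  split_ifs <;> omega

/-- **Leg-count parity** (`N ≥ 2`). With `s_k = (l.take k).sum`, `l.sum = 0`, `t + t = 0`: the number of legs equal to `t`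
among the first legs `s_1..s_{N-2}`, the middle legs `β_2..β_{N-1}` and the last legs `-s_2..-s_{N-1}` of the `N - 2` comb
pieces `(s_{k-1}, β_k, -s_k)` has the parity of `l.count t`. [folklore] -/
theorem combPieces_legs_count_add_even_iff (t : ZMod m) (ht : t + t = 0) (l : List (ZMod m)) (hl : 2 ≤ l.length)
    (hs : l.sum = 0) :
    Even (((List.range (l.length - 2)).map (fun j => (l.take (j + 1)).sum)).count t
        + ((l.drop 1).take (l.length - 2)).count t
        + ((List.range (l.length - 2)).map (fun j => -(l.take (j + 2)).sum)).count t)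
      ↔ Even (l.count t) := by
  by_cases h3 : 3 ≤ l.length
  · rw [combPieces_legs_count_eq t ht l h3 hs, Nat.even_add]
    simp
  · -- `N = 2`: no pieces; `l = [x, -x]` has an even number of letters `t`
    have hN : l.length = 2 := by omega
    have e0 : l.length - 2 = 0 := by omega
    rw [e0]
    simp only [List.range_zero, List.map_nil, List.count_nil, List.take_zero, add_zero, Even.zero,
      true_iff]
    obtain ⟨x, y, hxy⟩ : ∃ x y, l = [x, y] := by
      match l, hN with
      | [x, y], _ => exact ⟨x, y, rfl⟩
    subst hxy
    have hy : y = -x := by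
      simp only [List.sum_cons, List.sum_nil, add_zero] at hs
      exact (add_eq_zero_iff_neg_eq.mp hs).symm
    subst hy
    rw [List.count_cons, List.count_singleton']
    have hnt : -t = t := (neg_eq_iff_eq_of_add_self_eq_zero ht t).mpr rfl
    by_cases hx : x = t
    · subst hx
      simp [hnt]
    · have hnx : ¬ -x = t := fun h => hx ((neg_eq_iff_eq_of_add_self_eq_zero ht x).mp h)
      simp [hx, hnx]

/-- The middle legs as a function of the piece index: `((l.drop 1).take (N-2))` is the list of `l[j+1]`, `j < N - 2`.
[folklore] -/
theorem drop_one_take_eq_map_getD (l : List (ZMod m)) :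
    (l.drop 1).take (l.length - 2) = (List.range (l.length - 2)).map (fun j => l.getD (j + 1) 0) := by
  apply List.ext_getElem
  · simp; omega
  · intro i h1 h2
    simp only [List.length_take, List.length_drop] at h1
    simp only [List.getElem_take, List.getElem_drop, List.getElem_map, List.getElem_range, List.getD_eq_getElem?_getD]
    rw [List.getElem?_eq_getElem (by omega)]
    simp [add_comm]

/-- **A piece has at most one `t`-leg; the number of pieces with a `t`-leg.** If no letter of `l` is `0` and no proper
prefix sum is `0` (compact ordering), then for `t + t = 0` the number of indices `j < N - 2` whose piece
`(s_{j+1}, β_{j+2}, -s_{j+2})` has a leg equal to `t` equals the total number of `t`-legs (a piece with two `t`-legs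
would have third leg `-(t + t) = 0`). [folklore] -/
theorem combPieces_countP_hasLeg_eq (t : ZMod m) (ht : t + t = 0) (l : List (ZMod m))
    (h0 : ∀ x ∈ l, x ≠ 0) (hc : ∀ k < l.length, 0 < k → (l.take k).sum ≠ 0) :
    (List.range (l.length - 2)).countP
        (fun j => (l.take (j + 1)).sum = t ∨ l.getD (j + 1) 0 = t ∨ -(l.take (j + 2)).sum = t)
      = ((List.range (l.length - 2)).map (fun j => (l.take (j + 1)).sum)).count t
        + ((l.drop 1).take (l.length - 2)).count t
        + ((List.range (l.length - 2)).map (fun j => -(l.take (j + 2)).sum)).count t := by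
  rw [drop_one_take_eq_map_getD, count_map_eq_countP, count_map_eq_countP, count_map_eq_countP]
  -- the relation between the three legs of piece `j`
  have hrel : ∀ j < l.length - 2, (l.take (j + 2)).sum = (l.take (j + 1)).sum + l.getD (j + 1) 0 := by
    intro j hj
    rw [List.take_add_one, List.sum_append, List.getD_eq_getElem?_getD, List.getElem?_eq_getElem (by omega)]
    simp
  have hneg : -t = t := by have := congrArg (· - t) ht; simpa using this.symm
  apply countP_or_or_eq_of_exclusive
  · intro j hj; simp only [List.mem_range] at hj
    rintro ⟨ha, hb⟩
    have h2 := hc (j + 2) (by omega) (by omega)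
    rw [hrel j hj, ha, hb, ht] at h2
    exact h2 rfl
  · intro j hj; simp only [List.mem_range] at hj
    rintro ⟨ha, hb⟩
    have hb' : (l.take (j + 2)).sum = t := (neg_eq_iff_eq_of_add_self_eq_zero ht _).mp hb
    have hmem : l.getD (j + 1) 0 ∈ l := by
      rw [List.getD_eq_getElem?_getD, List.getElem?_eq_getElem (by omega)]; simp
    have := h0 _ hmem
    apply this
    have e := hrel j hj
    rw [ha, hb'] at e
    -- t = t + b ⟹ b = 0
    have := congrArg (· - t) e; simpa using this.symm
  · intro j hj; simp only [List.mem_range] at hj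
    rintro ⟨ha, hb⟩
    have hb' : (l.take (j + 2)).sum = t := (neg_eq_iff_eq_of_add_self_eq_zero ht _).mp hb
    have h1 := hc (j + 1) (by omega) (by omega)
    apply h1
    have e := hrel j hj
    rw [ha, hb'] at e
    -- t = a + t ⟹ a = 0
    have := congrArg (· - t) e; simpa using this.symm

/-- **THEOREM (comb pieces, parity).** For every `m`, every `t ∈ ℤ/m` with `t + t = 0`, and every list `l` of NON-ZERO
residues with `l.sum = 0`, `l.length ≥ 2` and all proper prefix sums non-zero (a compact ordering), the number of comb
pieces `(s_{k-1}, β_k, -s_k)` (`2 ≤ k ≤ N-1`) having a leg equal to `t` is congruent mod `2` to the number of letters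
`βᵢ = t`. (Step (3) of the packet's THEOREM DISC-6 / DISC-18: with the piece tables for `m = 6`, `t = 3` and `m = 18`,
`t = 9` over `K = ℚ(√-3)` the discriminant class is `(-1)^{n₀}·2^{#{i : βᵢ = t}}`.) [folklore] -/
theorem combPieces_even_iff (t : ZMod m) (ht : t + t = 0) (l : List (ZMod m)) (hl : 2 ≤ l.length)
    (h0 : ∀ x ∈ l, x ≠ 0) (hs : l.sum = 0) (hc : ∀ k < l.length, 0 < k → (l.take k).sum ≠ 0) :
    Even ((List.range (l.length - 2)).countP
        (fun j => (l.take (j + 1)).sum = t ∨ l.getD (j + 1) 0 = t ∨ -(l.take (j + 2)).sum = t))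
      ↔ Even (l.count t) := by
  rw [combPieces_countP_hasLeg_eq t ht l h0 hc]
  exact combPieces_legs_count_add_even_iff t ht l hl hs

/-- **Compact orderings exist for `N = 4`, every `m`.** Four non-zero residues with sum `0`, not all four equal to one
element `a` with `a + a = 0`, can be listed with all proper prefix sums non-zero (some pair has non-zero sum; put it
first). This is the hypothesis of THEOREM DISC-PIECES for every quadruple of the packet's scans (a connected tuple is
never `(m/2, m/2, m/2, m/2)`). [folklore] -/
theorem compactOrdering_exists_four (a b c d : ZMod m) (ha : a ≠ 0) (hb : b ≠ 0) (hc : c ≠ 0) (hd : d ≠ 0)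
    (hs : a + b + c + d = 0) (hne : ¬ (b = a ∧ c = a ∧ d = a ∧ a + a = 0)) :
    ∃ l : List (ZMod m), l.Perm [a, b, c, d] ∧ ∀ k < l.length, 0 < k → (l.take k).sum ≠ 0 := by
  -- a compact ordering of four letters `[x, y, z, w]` with `x + y + z + w = 0`: `x ≠ 0`, `x + y ≠ 0`, `w ≠ 0`
  have key : ∀ x y z w : ZMod m, x ≠ 0 → x + y ≠ 0 → w ≠ 0 → x + y + z + w = 0 →
      ∀ k < [x, y, z, w].length, 0 < k → (([x, y, z, w] : List (ZMod m)).take k).sum ≠ 0 := by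
    intro x y z w hx hxy hw hsum k hk hk0
    simp only [List.length_cons, List.length_nil] at hk
    interval_cases k
    · simpa using hx
    · simpa using hxy
    · have e : x + y + z = -w := by
        have := congrArg (· - w) hsum; simpa [add_sub_cancel_right] using this
      simp only [List.take_succ_cons, List.take_zero, List.sum_cons, List.sum_nil, add_zero, ← add_assoc, e, ne_eq,
        neg_eq_zero]
      exact hw
  by_cases h1 : a + b ≠ 0
  · exact ⟨[a, b, c, d], List.Perm.refl _, key a b c d ha h1 hd hs⟩
  by_cases h2 : a + c ≠ 0
  · refine ⟨[a, c, b, d], ?_, key a c b d ha h2 hd (by rw [← hs]; ring)⟩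
    exact List.Perm.cons a (List.Perm.swap b c [d])
  by_cases h3 : a + d ≠ 0
  · refine ⟨[a, d, b, c], ?_, key a d b c ha h3 hc (by rw [← hs]; ring)⟩
    -- [d, b, c] ~ [b, c, d]
    exact List.Perm.cons a ((List.Perm.swap b d [c]).trans (List.Perm.cons b (List.Perm.swap c d [])))
  push Not at h1 h2 h3
  have eb : b = -a := (add_eq_zero_iff_eq_neg.mp (by rw [add_comm]; exact h1))
  have ec : c = -a := (add_eq_zero_iff_eq_neg.mp (by rw [add_comm]; exact h2))
  have ed : d = -a := (add_eq_zero_iff_eq_neg.mp (by rw [add_comm]; exact h3))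
  by_cases h4 : b + c ≠ 0
  · refine ⟨[b, c, a, d], ?_, key b c a d hb h4 hd (by rw [← hs]; ring)⟩
    -- [b, c, a, d] ~ [b, a, c, d] ~ [a, b, c, d]
    exact (List.Perm.cons b (List.Perm.swap a c [d])).trans (List.Perm.swap a b [c, d])
  · push Not at h4
    exfalso
    rw [eb, ec] at h4
    have haa : a + a = 0 := by
      have := congrArg Neg.neg h4; simp only [neg_add, neg_neg, neg_zero] at this; exact this
    have hna : -a = a := by have := congrArg (· - a) haa; simpa using this.symm
    exact hne ⟨by rw [eb, hna], by rw [ec, hna], by rw [ed, hna], haa⟩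

end CombPieces

end Summit.HodgeConjecture.HodgeConjecture.WeilTypeLadder
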